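import Summits.BirchSwinnertonDyer.BirchSwinnertonDyer.Theorems.AlignedTransportAtTwoMainConjectureOfRankZeroBSDAtTwoFineRoadDescentKernel
import Summits.BirchSwinnertonDyer.BirchSwinnertonDyer.Theorems.AlignedTransportAtTwoMainConjectureOfRankZeroBSDAtTwoFineRoadLocalTwo
import Literature.NumberTheory.EllipticCurves.IwasawaEulerCharDualityProofs
import HarnessLib

/-!
# Road (b″) netted, the relaxed descent `fd` for EVERY elliptic `W/ℚ`: `coker fd ≅ (ker res)^∨` is FINITE
# (receptacle-free; the seed-cell hypothesis of `…FineRoadDescentKernel` removed, using `…FineRoadLocalTwo`)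

Cell `bsd-f1-sign2`, WIDTH-5 attach seat `bsd-line-att-p4` (gen 4) on line `birth` of crux C2
stmt-BirchSwinnertonDyer-22298 `MainConjectureOfRankZeroBSDAtTwo`; a `--supports 22298 --as helper` file, sequel of `…FineRoadDescentKernel`.
HONEST FRAMING: THEOREMS ONLY — no definition, no named fact, no `sorry`; BSD is NOT proved by any of this.

* §1 (abstract) `finite_quotient_of_finite_ker`: pinned duals `X ≅ Hom(S, ℚ/ℤ)` (onto), `Xr ≅ Hom(R, ℚ/ℤ)` (bijective), an additive `j : R → S`
  with FINITE kernel, a subgroup `N ≤ X` and an additive `g : X ⧸ N → Xr` with `toDualR (g [x]) r = toDual x (j r)` ⟹ `Xr ⧸ range g` is finite: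
  `range g = {x | toDualR x` vanishes on `ker j}` (Baer along `R/ker j ↪ S`), so `Xr / range g ↪ Hom(ker j, ℚ/ℤ)`, finite
  (tree `PontryaginCard.finite_characterModule_of_finite`).
* §2 **`finite_coker_fd_of_isElliptic`**: for EVERY elliptic `W/ℚ` (rational `2`-torsion allowed), the cyclotomic `κ`, ANY `Λ`-module `X'` pinned
  to `Sel_{2^∞}(E/ℚ(ζ_{2^∞}))`, ANY `Λ`-linear `cX`, ANY `Λ`-module `Xr` pinned to `Sel^{rel ∞}(ℚ_∞)` and ANY compatible `Λ`-linear
  `fd : X' ⧸ range(cX − 1) → Xr`: `Finite (Xr ⧸ range fd)` — the kernel of `res` on `H¹(ℚ_∞, E[2^∞])` is finite UNCONDITIONALLY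
  (`LocalTwo.finite_ker_res_kerCyclotomicCharacter_two`: no Ribet, no Imai).

References: R. Greenberg, LNM 1716 (1999), §3 Lemma 3.1; J.-P. Serre, *Cours d'arithmétique* VI §1.
-/

set_option autoImplicit false
-- the Theorems namespace of this sub repeats the summit name by design (D-0017 nested layout)
set_option linter.dupNamespace false

noncomputable section

open scoped Classical

namespace Summit.BirchSwinnertonDyer.BirchSwinnertonDyer.Theorems.AlignedTransportAtTwoFineRoad.DescentCoker

open Literature.NumberTheory.EllipticCurves Literature.NumberTheory.EllipticCurves.IwasawaAlgebra

/-! ## §1 Abstract: the cokernel of the dual of a map with finite kernel is finite -/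

section Abstract

variable {S R : Type*} [AddCommGroup S] [AddCommGroup R] (j : R →+ S)
  {X Xr : Type*} [AddCommGroup X] [AddCommGroup Xr]
  (toDual : X →+ (S →+ AddCircle (1 : ℚ))) (toDualR : Xr →+ (R →+ AddCircle (1 : ℚ)))

/-- **An element of `Xr` whose character vanishes on `ker j` is in the image of the dual map.** If `toDualR x` kills `ker j`, it
factors through `R / ker j ≅ j(R) ≤ S`; extending to `S` (`ℚ/ℤ` divisible, Baer) and pulling back through `toDual` (onto) gives a
preimage under any `g` with `toDualR (g x') r = toDual x' (j r)`. [cite: GreenbergLNM1716, §3 Lemma 3.1] -/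
theorem exists_eq_of_forall_ker_eq_zero (hD : Function.Surjective toDual) (hR : Function.Injective toDualR)
    {Q : Type*} (mk : X → Q) {g : Q → Xr} (hg : ∀ (x : X) (r : R), toDualR (g (mk x)) r = toDual x (j r))
    {x : Xr} (hx : ∀ r : R, j r = 0 → toDualR x r = 0) : ∃ q : Q, g q = x := by
  -- `toDualR x` factors through `R ⧸ ker j ≅ range j`
  have hle : j.ker ≤ (toDualR x).ker := fun r hr ↦ (AddMonoidHom.mem_ker).mpr (hx r ((AddMonoidHom.mem_ker).mp hr))
  set ψ : R ⧸ j.ker →+ AddCircle (1 : ℚ) := QuotientAddGroup.lift j.ker (toDualR x) hle with hψ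
  set e := QuotientAddGroup.quotientKerEquivRange j with he
  have he_mk : ∀ r : R, e (QuotientAddGroup.mk r) = ⟨j r, ⟨r, rfl⟩⟩ := fun r ↦ rfl
  set w : j.range →+ AddCircle (1 : ℚ) := ψ.comp e.symm.toAddMonoidHom with hw
  have hw_apply : ∀ r : R, w ⟨j r, ⟨r, rfl⟩⟩ = toDualR x r := by
    intro r
    rw [hw, AddMonoidHom.comp_apply, AddEquiv.coe_toAddMonoidHom, ← he_mk, AddEquiv.symm_apply_apply, hψ,
      QuotientAddGroup.lift_mk]
  -- extend `w` to `S`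
  have hinj : Function.Injective j.range.subtype.toIntLinearMap := Subtype.val_injective
  obtain ⟨L, hL⟩ := CharacterModule.dual_surjective_of_injective (R := ℤ) j.range.subtype.toIntLinearMap hinj
    (w : CharacterModule j.range)
  have hL_apply : ∀ r : R, L (j r) = toDualR x r := by
    intro r
    have h1 : L (j r) = w ⟨j r, ⟨r, rfl⟩⟩ := congrArg (fun χ : CharacterModule j.range ↦ χ ⟨j r, ⟨r, rfl⟩⟩) hL
    exact h1.trans (hw_apply r)
  obtain ⟨x', hx'⟩ := hD L
  refine ⟨mk x', hR (AddMonoidHom.ext fun r ↦ ?_)⟩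
  rw [hg, hx']
  exact hL_apply r

/-- **`coker g` is finite when `ker j` is.** For pinned duals `X ≅ Hom(S, ℚ/ℤ)` (onto), `Xr ≅ Hom(R, ℚ/ℤ)` (bijective), `j : R → S` with
FINITE kernel, a `Λ`-submodule `N ≤ X` and a `Λ`-linear `g : X ⧸ N → Xr` with `toDualR (g [x]) r = toDual x (j r)`: `Xr ⧸ range g` is finite —
it embeds into `Hom(ker j, ℚ/ℤ)` (restriction of `toDualR`; kernel = `range g` by `exists_eq_of_forall_ker_eq_zero`), and the character group of
a finite group is finite (tree `PontryaginCard.finite_characterModule_of_finite`). [cite: GreenbergLNM1716, §3 Lemma 3.1] -/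
theorem finite_quotient_of_finite_ker [_root_.Module (IwasawaAlgebra 2) X] [_root_.Module (IwasawaAlgebra 2) Xr]
    (hD : Function.Surjective toDual)
    (hR : Function.Bijective toDualR) [Finite j.ker] (N : Submodule (IwasawaAlgebra 2) X)
    (g : (X ⧸ N) →ₗ[IwasawaAlgebra 2] Xr)
    (hg : ∀ (x : X) (r : R), toDualR (g (Submodule.Quotient.mk x)) r = toDual x (j r)) :
    Finite (Xr ⧸ LinearMap.range g) := by
  haveI : Finite (CharacterModule j.ker) := PontryaginCard.finite_characterModule_of_finite j.ker
  -- restriction of `toDualR x` to `ker j`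
  let ρ : Xr →+ CharacterModule j.ker :=
    { toFun := fun x ↦ (toDualR x).comp j.ker.subtype
      map_zero' := by rw [map_zero, AddMonoidHom.zero_comp]; rfl
      map_add' := fun x y ↦ by rw [map_add, AddMonoidHom.add_comp]; rfl }
  have hρ : ∀ (x : Xr) (k : j.ker), ρ x k = toDualR x k := fun _ _ ↦ rfl
  -- `range g ≤ ker ρ`
  have hle : ∀ x ∈ LinearMap.range g, ρ x = 0 := by
    rintro _ ⟨q, rfl⟩
    obtain ⟨x₀, rfl⟩ := Submodule.Quotient.mk_surjective N q
    ext k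
    rw [hρ, hg, (AddMonoidHom.mem_ker).mp k.2, map_zero]
    rfl
  -- `ker ρ ≤ range g`
  have hker : ∀ x : Xr, ρ x = 0 → x ∈ LinearMap.range g := by
    intro x hx
    have hx' : ∀ r : R, j r = 0 → toDualR x r = 0 := by
      intro r hr
      have := congrArg (fun χ : CharacterModule j.ker ↦ χ ⟨r, (AddMonoidHom.mem_ker).mpr hr⟩) hx
      exact this
    obtain ⟨q, hq⟩ := exists_eq_of_forall_ker_eq_zero j toDual toDualR hD hR.injective (Submodule.Quotient.mk (p := N))
      (g := fun q ↦ g q) hg hx'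
    exact ⟨q, hq⟩
  -- `x̄ ↦ ρ x` is well defined and injective on `Xr ⧸ range g`
  let rep : (Xr ⧸ LinearMap.range g) → Xr := fun q ↦ Classical.choose (Submodule.Quotient.mk_surjective _ q)
  have hrep : ∀ q, Submodule.Quotient.mk (rep q) = q := fun q ↦
    Classical.choose_spec (Submodule.Quotient.mk_surjective _ q)
  refine Finite.of_injective (fun q ↦ ρ (rep q)) fun q q' hqq' ↦ ?_
  have h0 : ρ (rep q - rep q') = 0 := by
    rw [map_sub, sub_eq_zero]
    exact hqq'
  rw [← hrep q, ← hrep q', Submodule.Quotient.eq]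
  exact hker _ h0

end Abstract

/-! ## §2 Every elliptic `W/ℚ`: `coker fd` is finite -/

section General

open WeierstrassCurve Literature.NumberTheory.GaloisRepresentations ZpExtension
  Literature.NumberTheory.EllipticCurves.Greenberg1999

variable (κ : ZpExtension ℚ 2) (W : WeierstrassCurve ℚ) [W.IsElliptic]

/-- **`coker fd` is FINITE for every elliptic `W/ℚ`** (rational `2`-torsion allowed). For the cyclotomic `κ`, ANY `Λ`-module `X'` pinned to
`Sel_{2^∞}(E/ℚ(ζ_{2^∞}))` (`W.selmerGroupOver 2 (ker χ₂)`) by an additive bijection, ANY `Λ`-linear `cX`, ANY `Λ`-module `Xr` pinned to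
`Sel^{rel ∞}(ℚ_∞) = relaxedSelmerInftyAtTwo W κ`, and ANY `Λ`-linear `fd : X' ⧸ range(cX − 1) → Xr` dual to the restriction:
`Finite (Xr ⧸ range fd)` — `coker fd ↪ Hom(ker res, ℚ/ℤ)` and `ker(res : H¹(ℚ_∞, E[2^∞]) → H¹(ℚ(ζ_{2^∞}), E[2^∞]))` is finite unconditionally
(`LocalTwo.finite_ker_res_kerCyclotomicCharacter_two`). The K₂ⁿᵉᵗʳ conjunct without the seed-cell hypothesis.
[cite: GreenbergLNM1716, §3 Lemma 3.1] [cite: Kato2004Asterisque, §17.13] -/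
theorem finite_coker_fd_of_isElliptic (hκ : κ.IsCyclotomic)
    {X' : Type*} [AddCommGroup X'] [_root_.Module (IwasawaAlgebra 2) X']
    (toDual' : X' →+ (W.selmerGroupOver 2 (GaloisRep.cyclotomicCharacter ℚ 2).toMonoidHom.ker →+ AddCircle (1 : ℚ)))
    (hD : Function.Bijective toDual') (cX : X' →ₗ[IwasawaAlgebra 2] X')
    {Xr : Type*} [AddCommGroup Xr] [_root_.Module (IwasawaAlgebra 2) Xr]
    (toDualR : Xr →+ (relaxedSelmerInftyAtTwo W κ →+ AddCircle (1 : ℚ))) (hR : Function.Bijective toDualR)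
    (fd : (X' ⧸ LinearMap.range (cX - 1)) →ₗ[IwasawaAlgebra 2] Xr)
    (hfd : ∀ (x : X') (s : relaxedSelmerInftyAtTwo W κ),
      toDualR (fd (Submodule.Quotient.mk x)) s =
        toDual' x ⟨W.resOfLe 2 (InfRes.ker_cyclotomicCharacter_le_kerSubgroup κ hκ) s,
          DescentKernel.resOfLe_mem_selmerGroupOver_of_mem_relaxed κ W hκ s⟩) :
    Finite (Xr ⧸ LinearMap.range fd) := by
  set h := InfRes.ker_cyclotomicCharacter_le_kerSubgroup κ hκ with hh
  let j : relaxedSelmerInftyAtTwo W κ →+ W.selmerGroupOver 2 (GaloisRep.cyclotomicCharacter ℚ 2).toMonoidHom.ker :=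
    ((W.resOfLe 2 h).comp (relaxedSelmerInftyAtTwo W κ).subtype).codRestrict _
      fun s ↦ DescentKernel.resOfLe_mem_selmerGroupOver_of_mem_relaxed κ W hκ s
  -- `ker j` embeds into the finite inf–res kernel
  haveI : Finite j.ker := by
    haveI := (LocalTwo.finite_ker_res_kerCyclotomicCharacter_two κ W hκ).to_subtype
    refine Finite.of_injective (fun s : j.ker ↦
      (⟨((s : relaxedSelmerInftyAtTwo W κ) : W.subgroupH1 2 κ.kerSubgroup), ?_⟩ :
        {c : W.subgroupH1 2 κ.kerSubgroup | W.resOfLe 2 h c = 0})) ?_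
    · have hs := (AddMonoidHom.mem_ker).mp s.2
      exact congrArg (fun u : W.selmerGroupOver 2 (GaloisRep.cyclotomicCharacter ℚ 2).toMonoidHom.ker ↦
        (u : W.subgroupH1 2 (GaloisRep.cyclotomicCharacter ℚ 2).toMonoidHom.ker)) hs
    · intro s s' hss'
      have e := congrArg Subtype.val hss'
      dsimp only at e
      exact Subtype.ext (Subtype.ext e)
  exact finite_quotient_of_finite_ker j toDual' toDualR hD.surjective hR (LinearMap.range (cX - 1)) fd
    fun x s ↦ hfd x s

end General

end Summit.BirchSwinnertonDyer.BirchSwinnertonDyer.Theorems.AlignedTransportAtTwoFineRoad.DescentCoker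

end
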